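import Mathlib
import HarnessLib

/-!
# Crux K2 `PoloidalWindowRigidity` (stmt-NavierStokesRegularity-19708), line `z_shock` — NEGATIVE KERNEL BRICK 4 for the class-free
# slice Liouville `hGN`: the FIRST-ORDER DICTIONARY of the oblique travelling lift of a p-system solution

`--supports stmt-NavierStokesRegularity-19708 --as helper` (leafhand-ns-poloidalwindowdoor-3 g34, cell decomp-ns, 2026-09-01).
Class-free, def-free, Mathlib only (pure algebra).  **No stub and no summit is closed by this file; Navier–Stokes regularity is NOT
proved here (rung 0).**  Companion of `…ZShockHodographDarboux` (p842123), `…ZShockHodographHump` (p842197),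
`…ZShockHodographJacobian` and the evidence memo `HGN-COUNTEREXAMPLE-leafhand3-g34.md` §4.

THE LIFT (memo §4).  Let `(σ, ρ)(τ, ξ)` solve the autonomous p-system in Riemann-invariant form, `σ_τ = −k(ρ)ρ_ξ`,
`ρ_τ = −k(ρ)σ_ξ` (`σ = (r+s)/2`, `ρ = (r−s)/2`, speed `k > 0`), let `𝒲' = 1/k`, `𝒫' = k`, `κ₀ ≠ 0`, and put on `ℝ³ ∋ (y₀, y₁, y₂)`
  `u₀ = −σ/κ₀`, `u₁ = 𝒲(ρ)/κ₀`, `u₂ = (𝒲(ρ) + 𝒫(ρ))/κ₀²`  evaluated at `(τ, ξ) = (y₀, y₁ − κ₀ y₂)`.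
By the chain rule the nine first derivatives `D i j = ∂ᵢuⱼ` at a point are the numbers listed in the hypotheses of
`oblique_first_order` below (`A = σ_ξ`, `B = ρ_ξ`; the travelling structure is `∂₂uⱼ = −κ₀ ∂₁uⱼ`).  THIS FILE checks, as identities
between real numbers, that then ALL FIRST-ORDER CLAUSES OF `hGN` HOLD AT THE POINT:
  divergence-free (`D00 + D11 + D22 = 0`), `e₂`-poloidal (`D01 − D10 = 0`), the wedge law (`D20·D12 − D21·D02 = 0`), the SLOPE LAW
  `D2b = g·Db2` (`b = 0, 1`) with the slope `g = −κ₀²/(1 + k²)` a function of `ρ` alone (hence of `u₂`: autonomy), and the type scalar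
  `D20·D02 + D21·D12 = −(1 + k²)(A² + B²/k²)/κ₀² ≤ 0`, `< 0` unless `A = B = 0` — uniformly HYPERBOLIC, no elliptic pocket.
(The second-order clauses — vanishing autonomy minors from the slope law, a twisting point, a genuinely nonlinear point where `k' ≠ 0` —
and boundedness / analyticity are in the memo; the Jacobian facts making `(σ, ρ)` a bounded entire analytic solution are bricks 1–3.)
[folklore]
-/

noncomputable section

namespace Summit.NavierStokesRegularity.NavierStokesRegularity.Theorems.PoloidalWindowDoorPoloidalWindowRigidityZShockHodographOblique

-- the problem directory repeats the summit name (`NavierStokesRegularity/NavierStokesRegularity`)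
set_option linter.dupNamespace false

/-- ★ **First-order dictionary of the oblique lift.**  With `στ = −kB`, `ρτ = −kA` (the p-system at the point; `A = σ_ξ`, `B = ρ_ξ`)
and the chain-rule values of the nine first derivatives of the lift (`D i j = ∂ᵢ uⱼ`; travelling structure `D 2 j = −κ₀ D 1 j`):
divergence-free, `e₂`-poloidal, wedge law, slope law with slope `−κ₀²/(1+k²)`, and the hyperbolic sign of the type scalar. [folklore] -/
theorem oblique_first_order (k κ₀ A B στ ρτ D00 D01 D02 D10 D11 D12 D20 D21 D22 : ℝ) (hk : k ≠ 0) (hκ : κ₀ ≠ 0)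
    (hστ : στ = -k * B) (hρτ : ρτ = -k * A)
    (h00 : D00 = -στ / κ₀) (h10 : D10 = -A / κ₀)
    (h01 : D01 = (1 / k) * ρτ / κ₀) (h11 : D11 = (1 / k) * B / κ₀)
    (h02 : D02 = (1 / k + k) * ρτ / κ₀ ^ 2) (h12 : D12 = (1 / k + k) * B / κ₀ ^ 2)
    (h20 : D20 = -κ₀ * D10) (h21 : D21 = -κ₀ * D11) (h22 : D22 = -κ₀ * D12) :
    D00 + D11 + D22 = 0 ∧
      D01 - D10 = 0 ∧
      D20 * D12 - D21 * D02 = 0 ∧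
      (D20 = -κ₀ ^ 2 / (1 + k ^ 2) * D02 ∧ D21 = -κ₀ ^ 2 / (1 + k ^ 2) * D12) ∧
      D20 * D02 + D21 * D12 = -(1 + k ^ 2) * (A ^ 2 + B ^ 2 / k ^ 2) / κ₀ ^ 2 ∧
      D20 * D02 + D21 * D12 ≤ 0 ∧
      (A ≠ 0 ∨ B ≠ 0 → D20 * D02 + D21 * D12 < 0) := by
  have hk2 : (1 : ℝ) + k ^ 2 ≠ 0 := by positivity
  subst h20 h21 h22
  subst h00 h10 h01 h11 h02 h12
  subst hστ hρτ
  refine ⟨?_, ?_, ?_, ⟨?_, ?_⟩, ?_, ?_, ?_⟩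
  · field_simp; ring
  · field_simp; ring
  · field_simp; ring
  · field_simp
  · field_simp
  · field_simp; ring
  · -- sign
    have h : -κ₀ * (-A / κ₀) * ((1 / k + k) * (-k * A) / κ₀ ^ 2) +
        -κ₀ * (1 / k * B / κ₀) * ((1 / k + k) * B / κ₀ ^ 2) =
        -((1 + k ^ 2) * (A ^ 2 + B ^ 2 / k ^ 2) / κ₀ ^ 2) := by
      field_simp; ring
    rw [h, neg_nonpos]
    positivity
  · intro hAB
    have h : -κ₀ * (-A / κ₀) * ((1 / k + k) * (-k * A) / κ₀ ^ 2) +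
        -κ₀ * (1 / k * B / κ₀) * ((1 / k + k) * B / κ₀ ^ 2) =
        -((1 + k ^ 2) * (A ^ 2 + B ^ 2 / k ^ 2) / κ₀ ^ 2) := by
      field_simp; ring
    rw [h, neg_lt_zero]
    have hpos : 0 < A ^ 2 + B ^ 2 / k ^ 2 := by
      rcases hAB with hA | hB
      · have := pow_pos (abs_pos.mpr hA) 2
        rw [← sq_abs A]; positivity
      · have hB2 : 0 < B ^ 2 / k ^ 2 := by
          have := abs_pos.mpr hB
          rw [← sq_abs B]; positivity
        nlinarith [sq_nonneg A]
    positivity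

end Summit.NavierStokesRegularity.NavierStokesRegularity.Theorems.PoloidalWindowDoorPoloidalWindowRigidityZShockHodographOblique
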